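import Summits.Ventures.CertifiedArithmetic.LowPrec.GemmEnvelopePinned
import Summits.Ventures.CertifiedArithmetic.LowPrec.GemmEnvelopeRowsB
import Summits.Ventures.CertifiedArithmetic.LowPrec.GemmEnvelopeRowP5

/-!
# GEMM-level envelopes, part (r): the TIE rows against amax-exact per-vector datapaths (pub-lowprec gemm gen 22, LXX-r)

HONEST FRAMING: certified error envelopes and provably optimal rounding/accumulation schemes for
low-precision formats under stated cost models; every table by two implementations; no hardware or
vendor claims.

Rows P2/P5 (`MXC ≼ VEC-E4M3`, `κ ≤ θ = 258048/17`), P3 (`MXC ≼ INT8`, `κ ≥ 254/17`) and P6 (`MXC ≼ VEC-E5M2`)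
say: every uniform relative bound `q` valid for the per-vector datapath on `C(κ)` is valid for MX-E4M3-ceil.
Parts (d), (e), (f) prove them with hypothesis `hY` ranging over ALL pairs `(input, numerator)` of the class and
exercise it at constant blocks whose numerator is not attained (`17/2` with `127`, `x ∈ (272, 288)` with `448`,
`38000` with `57344`).  Here `hY` is WEAKENED to amax-exact inputs — the numerator is attained in every vector,
as an implementation computing `A = max |vᵢ|` produces — and the rows still hold (vectors of length `≥ 3`): the
witnesses are PINNED with part (q) (`pinned_class`, `pinned_sums`), the ratio read off by
`ratio_le_of_scaled_witness`.
* `row_P3_mxCeil_le_int8_amax` (`254/17 ≤ κ ≤ 14336`), `row_P6_mxCeil_le_vecE5M2_amax` (`2 ≤ κ ≤ 14336`),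
  `row_P25_mxCeil_le_vecE4M3_amax` (`2 ≤ κ ≤ 258048/17`, rows P2 and P5 up to the crossover).
This removes the last modelling caveat of the decision table (numerator slot vs ideal amax): together with part
(q) every per-vector witness used by rows P2–P7 has an amax-exact twin with the same value. Cert
GEMM-ENVELOPES-ROBUST.json realises pinned inputs only. [cite: RouhaniEtAl2023MX, §5.1, §6.3]; [cite: MicikeviciusEtAl2022, §3]
-/

namespace Summit.Ventures.CertifiedArithmetic.LowPrec.GemmEnvelope

open Finset
open Literature.ComputerArithmetic.FloatingPoint
open Literature.ComputerArithmetic.FloatingPoint.Format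
open Literature.ComputerArithmetic.FloatingPoint.MiniFloat
open Literature.ComputerArithmetic.FloatingPoint.MXBlock
open Summit.Ventures.CertifiedArithmetic.LowPrec.SR

/-- Reading a ratio bound off a scaled constant-cell witness: `|N·P - N·X| ≤ q·N·|X|`, `N, X > 0` gives
`(P - X)/X ≤ q` and `(X - P)/X ≤ q`. [cite: RouhaniEtAl2023MX, §5.1] -/
theorem ratio_le_of_scaled_witness {N P X q : ℚ} (hN : 0 < N) (hX : 0 < X)
    (h : |N * P - N * X| ≤ q * (N * |X|)) : (P - X) / X ≤ q ∧ (X - P) / X ≤ q := by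
  rw [abs_of_pos hX, ← mul_sub, abs_mul, abs_of_pos hN] at h
  have h' : N * |P - X| ≤ N * (q * X) := by linarith
  have h2 : |P - X| ≤ q * X := le_of_mul_le_mul_left h' hN
  constructor <;> rw [div_le_iff₀ hX] <;> linarith [le_abs_self (P - X), neg_abs_le (P - X)]

/-- **ROW P3 against amax-exact INT8** (`254/17 ≤ κ ≤ 14336`, vectors of length `≥ 3`): every uniform bound `q`
valid for per-vector INT8 on the amax-exact inputs of `C(κ)` is valid for MX-E4M3-ceil on `C(κ)` (pinned witness
`(127, 0, 17/2, …)·(0, 127, 17/2, …)`, `8.5 ↦ 9`, forcing `q ≥ 35/289`). [cite: RouhaniEtAl2023MX, §5.1] -/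
theorem row_P3_mxCeil_le_int8_amax {B k : ℕ} (hB : 0 < B) (hk : 3 ≤ k) {κ : ℚ} (hκ1 : 254 / 17 ≤ κ)
    (hκ2 : κ ≤ 14336) (q : ℚ)
    (hY : ∀ (a b : Fin B → Fin k → ℚ) (Aa Ab : ℚ),
      (∀ j i, |a j i| ≤ Aa ∧ (a j i = 0 ∨ Aa ≤ κ * |a j i|)) → (∀ j, ∃ i, |a j i| = Aa) →
      (∀ j i, |b j i| ≤ Ab ∧ (b j i = 0 ∨ Ab ≤ κ * |b j i|)) → (∀ j, ∃ i, |b j i| = Ab) →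
      |∑ j, ∑ i, (Aa / 127 * (round (a j i / (Aa / 127)) : ℚ)) *
          (Ab / 127 * (round (b j i / (Ab / 127)) : ℚ)) - ∑ j, ∑ i, a j i * b j i|
        ≤ q * ∑ j, ∑ i, |a j i * b j i|)
    (a b : Fin B → Fin k → ℚ) (Aa Ab : ℚ)
    (ha : ∀ j i, |a j i| ≤ Aa ∧ (a j i = 0 ∨ Aa ≤ κ * |a j i|))
    (hb : ∀ j i, |b j i| ≤ Ab ∧ (b j i = 0 ∨ Ab ≤ κ * |b j i|)) :
    |∑ j, ∑ i, (ceilScale E4M3 (a j) * (roundNE E4M3 (a j i / ceilScale E4M3 (a j))).toRat) *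
        (ceilScale E4M3 (b j) * (roundNE E4M3 (b j i / ceilScale E4M3 (b j))).toRat)
        - ∑ j, ∑ i, a j i * b j i| ≤ q * ∑ j, ∑ i, |a j i * b j i| := by
  obtain ⟨n, rfl⟩ : ∃ n, k = n + 3 := ⟨k - 3, by omega⟩
  set a' : Fin (n + 3) → ℚ := Fin.cases (127 : ℚ) (Fin.cases (0 : ℚ) (fun _ : Fin (n + 1) => (17 : ℚ) / 2))
    with ha'
  set b' : Fin (n + 3) → ℚ := Fin.cases (0 : ℚ) (Fin.cases (127 : ℚ) (fun _ : Fin (n + 1) => (17 : ℚ) / 2))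
    with hb'
  obtain ⟨hca, hcb, ha0, hb1⟩ := pinned_class (n := n) (by norm_num : (0 : ℚ) < 17 / 2)
    (by norm_num : (17 : ℚ) / 2 ≤ 127) (by linarith : (127 : ℚ) ≤ κ * (17 / 2)) ha' hb'
  obtain ⟨hS1, -, hS2, hS3⟩ := pinned_sums (n := n) (A := 127) (x := 17 / 2)
    (fun y : ℚ => (127 : ℚ) / 127 * (round (y / (127 / 127)) : ℚ)) (by simp) ha' hb'
  have h9 : (127 : ℚ) / 127 * (round ((17 : ℚ) / 2 / (127 / 127)) : ℚ) = 9 := by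
    rw [show (17 : ℚ) / 2 / (127 / 127) = 17 / 2 by norm_num, witness_values.2.2.2.2.2.1]; norm_num
  rw [h9] at hS1
  have hw := hY (fun _ => a') (fun _ => b') 127 127 (fun _ i => hca i) (fun _ => ⟨0, ha0⟩)
    (fun _ i => hcb i) (fun _ => ⟨Fin.succ 0, hb1⟩)
  simp only [hS1, hS2, hS3, sum_const, card_univ, Fintype.card_fin, nsmul_eq_mul] at hw
  have hN : (0 : ℚ) < (B : ℚ) * ((n + 1 : ℕ) : ℚ) := by
    have : (0 : ℚ) < (B : ℚ) := by exact_mod_cast hB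
    positivity
  have e1 : ((B : ℚ) * (((n + 1 : ℕ) : ℚ) * (9 * 9)) : ℚ) = (B : ℚ) * ((n + 1 : ℕ) : ℚ) * (9 * 9) := by ring
  have e3 : ((B : ℚ) * (((n + 1 : ℕ) : ℚ) * ((17 : ℚ) / 2 * (17 / 2))) : ℚ)
      = (B : ℚ) * ((n + 1 : ℕ) : ℚ) * (17 / 2 * (17 / 2)) := by ring
  have e4 : ((B : ℚ) * (((n + 1 : ℕ) : ℚ) * |(17 : ℚ) / 2 * (17 / 2)|) : ℚ)
      = (B : ℚ) * ((n + 1 : ℕ) : ℚ) * |(17 : ℚ) / 2 * (17 / 2)| := by ring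
  rw [e1, e3, e4] at hw
  have hq := (ratio_le_of_scaled_witness hN (by norm_num) hw).1
  norm_num at hq
  have hL : 0 ≤ ∑ j, ∑ i, |a j i * b j i| := sum_nonneg fun j _ => sum_nonneg fun i _ => abs_nonneg _
  exact le_trans (mxCeil_blocked_le a b hκ2 ha hb) (mul_le_mul_of_nonneg_right hq hL)

/-- **ROW P6 against amax-exact per-vector E5M2** (`2 ≤ κ ≤ 14336`, vectors of length `≥ 3`): every uniform
bound valid for per-vector E5M2 on the amax-exact inputs of `C(κ)` is valid for MX-E4M3-ceil (pinned witness
`(57344, 0, 38000, …)·(0, 57344, 38000, …)`, `38000 ↦ 40960`, forcing `q ≥ 36519/225625 > 35/289`).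
[cite: RouhaniEtAl2023MX, §6.3] -/
theorem row_P6_mxCeil_le_vecE5M2_amax {B k : ℕ} (hB : 0 < B) (hk : 3 ≤ k) {κ : ℚ} (hκ1 : 2 ≤ κ)
    (hκ2 : κ ≤ 14336) (q : ℚ)
    (hY : ∀ (a b : Fin B → Fin k → ℚ) (Aa Ab : ℚ),
      (∀ j i, |a j i| ≤ Aa ∧ (a j i = 0 ∨ Aa ≤ κ * |a j i|)) → (∀ j, ∃ i, |a j i| = Aa) →
      (∀ j i, |b j i| ≤ Ab ∧ (b j i = 0 ∨ Ab ≤ κ * |b j i|)) → (∀ j, ∃ i, |b j i| = Ab) →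
      |∑ j, ∑ i, (Aa / E5M2.maxRat * (roundNE E5M2 (a j i / (Aa / E5M2.maxRat))).toRat) *
          (Ab / E5M2.maxRat * (roundNE E5M2 (b j i / (Ab / E5M2.maxRat))).toRat)
          - ∑ j, ∑ i, a j i * b j i| ≤ q * ∑ j, ∑ i, |a j i * b j i|)
    (a b : Fin B → Fin k → ℚ) (Aa Ab : ℚ)
    (ha : ∀ j i, |a j i| ≤ Aa ∧ (a j i = 0 ∨ Aa ≤ κ * |a j i|))
    (hb : ∀ j i, |b j i| ≤ Ab ∧ (b j i = 0 ∨ Ab ≤ κ * |b j i|)) :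
    |∑ j, ∑ i, (ceilScale E4M3 (a j) * (roundNE E4M3 (a j i / ceilScale E4M3 (a j))).toRat) *
        (ceilScale E4M3 (b j) * (roundNE E4M3 (b j i / ceilScale E4M3 (b j))).toRat)
        - ∑ j, ∑ i, a j i * b j i| ≤ q * ∑ j, ∑ i, |a j i * b j i| := by
  obtain ⟨n, rfl⟩ : ∃ n, k = n + 3 := ⟨k - 3, by omega⟩
  have hM5 : E5M2.maxRat = 57344 := witness_values.2.2.2.2.2.2.2.2.1
  set a' : Fin (n + 3) → ℚ := Fin.cases (57344 : ℚ) (Fin.cases (0 : ℚ) (fun _ : Fin (n + 1) => (38000 : ℚ)))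
    with ha'
  set b' : Fin (n + 3) → ℚ := Fin.cases (0 : ℚ) (Fin.cases (57344 : ℚ) (fun _ : Fin (n + 1) => (38000 : ℚ)))
    with hb'
  obtain ⟨hca, hcb, ha0, hb1⟩ := pinned_class (n := n) (by norm_num : (0 : ℚ) < 38000)
    (by norm_num : (38000 : ℚ) ≤ 57344) (by linarith : (57344 : ℚ) ≤ κ * 38000) ha' hb'
  have hQ0 : (57344 : ℚ) / E5M2.maxRat * (roundNE E5M2 (0 / (57344 / E5M2.maxRat))).toRat = 0 := by
    rw [zero_div, toRat_roundNE_zero, mul_zero]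
  obtain ⟨hS1, -, hS2, hS3⟩ := pinned_sums (n := n) (A := 57344) (x := 38000)
    (fun y : ℚ => (57344 : ℚ) / E5M2.maxRat * (roundNE E5M2 (y / (57344 / E5M2.maxRat))).toRat) hQ0 ha' hb'
  have hq : (57344 : ℚ) / E5M2.maxRat * (roundNE E5M2 (38000 / (57344 / E5M2.maxRat))).toRat = 40960 := by
    rw [hM5, div_self (by norm_num : (57344 : ℚ) ≠ 0), div_one, witness_values.2.2.2.2.2.2.1, one_mul]
  rw [hq] at hS1
  have hw := hY (fun _ => a') (fun _ => b') 57344 57344 (fun _ i => hca i) (fun _ => ⟨0, ha0⟩)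
    (fun _ i => hcb i) (fun _ => ⟨Fin.succ 0, hb1⟩)
  simp only [hS1, hS2, hS3, sum_const, card_univ, Fintype.card_fin, nsmul_eq_mul] at hw
  have hN : (0 : ℚ) < (B : ℚ) * ((n + 1 : ℕ) : ℚ) := by
    have : (0 : ℚ) < (B : ℚ) := by exact_mod_cast hB
    positivity
  have e1 : ((B : ℚ) * (((n + 1 : ℕ) : ℚ) * (40960 * 40960)) : ℚ) = (B : ℚ) * ((n + 1 : ℕ) : ℚ) * (40960 * 40960) := by
    ring
  have e3 : ((B : ℚ) * (((n + 1 : ℕ) : ℚ) * (38000 * 38000)) : ℚ) = (B : ℚ) * ((n + 1 : ℕ) : ℚ) * (38000 * 38000) := by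
    ring
  have e4 : ((B : ℚ) * (((n + 1 : ℕ) : ℚ) * |(38000 : ℚ) * 38000|) : ℚ)
      = (B : ℚ) * ((n + 1 : ℕ) : ℚ) * |(38000 : ℚ) * 38000| := by ring
  rw [e1, e3, e4] at hw
  have hq' := (ratio_le_of_scaled_witness hN (by norm_num) hw).1
  norm_num at hq'
  have hL : 0 ≤ ∑ j, ∑ i, |a j i * b j i| := sum_nonneg fun j _ => sum_nonneg fun i _ => abs_nonneg _
  exact le_trans (mxCeil_blocked_le a b hκ2 ha hb) (mul_le_mul_of_nonneg_right (by linarith) hL)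

/-- **ROWS P2 / P5 against amax-exact per-vector E4M3** (`2 ≤ κ ≤ 258048/17`, vectors of length `≥ 3`): every
uniform bound valid for per-vector E4M3 on the amax-exact inputs of `C(κ)` is valid for MX-E4M3-ceil (pinned
approach family `(448, 0, x, …)·(0, 448, x, …)`, `x ↓ 272`, `x ↦ 288`, forcing `q ≥ 35/289`; MX side by the
sliver bound of part (f)). [cite: RouhaniEtAl2023MX, §5.1]; [cite: MicikeviciusEtAl2022, §3] -/
theorem row_P25_mxCeil_le_vecE4M3_amax {B k : ℕ} (hB : 0 < B) (hk : 3 ≤ k) {κ : ℚ} (hκ1 : 2 ≤ κ)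
    (hκ2 : κ ≤ 258048 / 17) (q : ℚ)
    (hY : ∀ (a b : Fin B → Fin k → ℚ) (Aa Ab : ℚ),
      (∀ j i, |a j i| ≤ Aa ∧ (a j i = 0 ∨ Aa ≤ κ * |a j i|)) → (∀ j, ∃ i, |a j i| = Aa) →
      (∀ j i, |b j i| ≤ Ab ∧ (b j i = 0 ∨ Ab ≤ κ * |b j i|)) → (∀ j, ∃ i, |b j i| = Ab) →
      |∑ j, ∑ i, (Aa / E4M3.maxRat * (roundNE E4M3 (a j i / (Aa / E4M3.maxRat))).toRat) *
          (Ab / E4M3.maxRat * (roundNE E4M3 (b j i / (Ab / E4M3.maxRat))).toRat)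
          - ∑ j, ∑ i, a j i * b j i| ≤ q * ∑ j, ∑ i, |a j i * b j i|)
    (a b : Fin B → Fin k → ℚ) (Aa Ab : ℚ)
    (ha : ∀ j i, |a j i| ≤ Aa ∧ (a j i = 0 ∨ Aa ≤ κ * |a j i|))
    (hb : ∀ j i, |b j i| ≤ Ab ∧ (b j i = 0 ∨ Ab ≤ κ * |b j i|)) :
    |∑ j, ∑ i, (ceilScale E4M3 (a j) * (roundNE E4M3 (a j i / ceilScale E4M3 (a j))).toRat) *
        (ceilScale E4M3 (b j) * (roundNE E4M3 (b j i / ceilScale E4M3 (b j))).toRat)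
        - ∑ j, ∑ i, a j i * b j i| ≤ q * ∑ j, ∑ i, |a j i * b j i| := by
  obtain ⟨n, rfl⟩ : ∃ n, k = n + 3 := ⟨k - 3, by omega⟩
  have hM : E4M3.maxRat = 448 := by decide +kernel
  have hN : (0 : ℚ) < (B : ℚ) * ((n + 1 : ℕ) : ℚ) := by
    have : (0 : ℚ) < (B : ℚ) := by exact_mod_cast hB
    positivity
  have hQ0 : (448 : ℚ) / E4M3.maxRat * (roundNE E4M3 (0 / (448 / E4M3.maxRat))).toRat = 0 := by
    rw [zero_div, toRat_roundNE_zero, mul_zero]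
  have hq : 35 / 289 ≤ q := by
    refine le_of_forall_approach fun x hx1 hx2 => ?_
    have hx0 : 0 < x := by linarith
    set a' : Fin (n + 3) → ℚ := Fin.cases (448 : ℚ) (Fin.cases (0 : ℚ) (fun _ : Fin (n + 1) => x)) with ha'
    set b' : Fin (n + 3) → ℚ := Fin.cases (0 : ℚ) (Fin.cases (448 : ℚ) (fun _ : Fin (n + 1) => x)) with hb'
    obtain ⟨hca, hcb, ha0, hb1⟩ := pinned_class (n := n) hx0 (by linarith : x ≤ 448)
      (by nlinarith : (448 : ℚ) ≤ κ * x) ha' hb'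
    obtain ⟨hS1, -, hS2, hS3⟩ := pinned_sums (n := n) (A := 448) (x := x)
      (fun y : ℚ => (448 : ℚ) / E4M3.maxRat * (roundNE E4M3 (y / (448 / E4M3.maxRat))).toRat) hQ0 ha' hb'
    have hv : (448 : ℚ) / E4M3.maxRat * (roundNE E4M3 (x / (448 / E4M3.maxRat))).toRat = 288 := by
      rw [hM, div_self (by norm_num : (448 : ℚ) ≠ 0), div_one, one_mul]
      exact toRat_roundNE_E4M3_eq_288 hx1 hx2.le
    rw [hv] at hS1
    have hw := hY (fun _ => a') (fun _ => b') 448 448 (fun _ i => hca i) (fun _ => ⟨0, ha0⟩)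
      (fun _ i => hcb i) (fun _ => ⟨Fin.succ 0, hb1⟩)
    simp only [hS1, hS2, hS3, sum_const, card_univ, Fintype.card_fin, nsmul_eq_mul] at hw
    have e1 : ((B : ℚ) * (((n + 1 : ℕ) : ℚ) * (288 * 288)) : ℚ) = (B : ℚ) * ((n + 1 : ℕ) : ℚ) * (288 * 288) := by
      ring
    have e3 : ((B : ℚ) * (((n + 1 : ℕ) : ℚ) * (x * x)) : ℚ) = (B : ℚ) * ((n + 1 : ℕ) : ℚ) * (x * x) := by ring
    have e4 : ((B : ℚ) * (((n + 1 : ℕ) : ℚ) * |x * x|) : ℚ) = (B : ℚ) * ((n + 1 : ℕ) : ℚ) * |x * x| := by ring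
    rw [e1, e3, e4] at hw
    exact (ratio_le_of_scaled_witness hN (mul_pos hx0 hx0) hw).1
  have hL : 0 ≤ ∑ j, ∑ i, |a j i * b j i| := sum_nonneg fun j _ => sum_nonneg fun i _ => abs_nonneg _
  exact le_trans (mxCeil_blocked_le_sliver a b hκ2 ha hb) (mul_le_mul_of_nonneg_right hq hL)

end Summit.Ventures.CertifiedArithmetic.LowPrec.GemmEnvelope
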